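import Summits.CriticalPhenomena.PercolationContinuityZ3.Theorems.PercNearOneGluingNoHeavyLowerTailAPLNonuniformPinned
import HarnessLib

/-!
# `NoHeavyLowerTail` (stmt-CriticalPhenomena-4575) — non-uniform APL, part V: the per-pattern slack of the glued induction

Support file (prover seat `prim-cert-1`, gen 16; `--supports stmt-CriticalPhenomena-4575`).  No definitions, no named facts, no sorries.
Part V (parts I–IV: `…APLNonuniformPaths/Fibres/Decoupling/Pinned`; algebra `…APLNonuniformStep`; theorem `…APLNonuniform`).

* `offD_eq_gluedD_union`, `real_offD_eq_add` — `μ(c ∉ T_b) = μ(ED) + μ(c ∉ T_b, b↔c ∨ (S↔b ∧ S↔c))` for every product law;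
  `real_gluedD_eq_add` — `μ(ED) = μ(U0) + μ(Eab) + μ(Eac)`;
* `pattern_slack` — **the per-pattern slack**: if the glued row with constant `c₁ ≤ 1` holds for every weight function and every apex set
  `S' ∌ b, c` with `|S'ᶜ| ≤ m+1`, and `|Sᶜ| ≤ m+2`, then for every pattern `ξ` of the crossing pairs of `S`, under the pinned law `ν_ξ`:
  `c₁·ν_ξ(ED)·ν_ξ(ET) ≤ ν_ξ(Eab) + ν_ξ(Eac)`.  Cases: a target is the endpoint of an open crossing pair (`ν_ξ(U0) = 0`, so `ED`-mass `≤ e`);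
  no open crossing pair (`ν_ξ(ET) = 0`); otherwise the hypothesis for `S ∪ R(ξ)` transported by `pin_real_glued_eq`.
[this work]
-/

noncomputable section

namespace Summit.CriticalPhenomena.PercolationContinuityZ3.Theorems

namespace APL

open MeasureTheory Literature.Probability.Percolation Literature.Probability.LatticeModels
open scoped Classical

/-! ### The per-pattern slack -/

section Slack

variable {n : ℕ} (w : Sym2 (Fin n) → unitInterval) (S : Finset (Fin n)) (b c : Fin n)

/-- `{c ∉ T_b}` splits as `ED ⊔ ({c ∉ T_b} ∩ (b↔c ∪ (S↔b ∩ S↔c)))`. [folklore] -/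
theorem offD_eq_gluedD_union (X : Set (Fin n)) :
    {ω : BondConfig (Fin n) | c ∉ openCluster (ω ∩ {e | ∀ x ∈ e, x ∉ X}) b} =
      ((openConn b c)ᶜ ∩ ({ω : BondConfig (Fin n) | ∃ s ∈ X, ω ∈ openConn s b} ∩ {ω | ∃ s ∈ X, ω ∈ openConn s c})ᶜ) ∪
        ({ω : BondConfig (Fin n) | c ∉ openCluster (ω ∩ {e | ∀ x ∈ e, x ∉ X}) b} ∩
          (openConn b c ∪ ({ω : BondConfig (Fin n) | ∃ s ∈ X, ω ∈ openConn s b} ∩ {ω | ∃ s ∈ X, ω ∈ openConn s c}))) := by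
  ext ω
  simp only [Set.mem_union, Set.mem_inter_iff, Set.mem_compl_iff, Set.mem_setOf_eq]
  constructor
  · intro hcT
    by_cases h : ω ∈ openConn b c ∨ ((∃ s ∈ X, ω ∈ openConn s b) ∧ ∃ s ∈ X, ω ∈ openConn s c)
    · exact Or.inr ⟨hcT, h⟩
    · exact Or.inl ⟨fun hbc => h (Or.inl hbc), fun hh => h (Or.inr hh)⟩
  · rintro (⟨hbc, -⟩ | ⟨hcT, -⟩)
    · exact fun hc' => hbc (openCluster_mono Set.inter_subset_left b hc' : c ∈ openCluster ω b)
    · exact hcT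

/-- The two parts are disjoint. [folklore] -/
theorem disjoint_gluedD_offX (X : Set (Fin n)) :
    Disjoint ((openConn b c)ᶜ ∩ ({ω : BondConfig (Fin n) | ∃ s ∈ X, ω ∈ openConn s b} ∩ {ω | ∃ s ∈ X, ω ∈ openConn s c})ᶜ)
      ({ω : BondConfig (Fin n) | c ∉ openCluster (ω ∩ {e | ∀ x ∈ e, x ∉ X}) b} ∩
        (openConn b c ∪ ({ω : BondConfig (Fin n) | ∃ s ∈ X, ω ∈ openConn s b} ∩ {ω | ∃ s ∈ X, ω ∈ openConn s c}))) := by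
  rw [Set.disjoint_left]
  rintro ω ⟨hbc, hnot⟩ ⟨-, h⟩
  rcases h with h | h
  · exact hbc h
  · exact hnot h

/-- `μ(c ∉ T_b) = μ(ED) + μ({c ∉ T_b} ∩ (b↔c ∪ (S↔b ∩ S↔c)))` for any product weights `v`. [folklore] -/
theorem real_offD_eq_add (v : Sym2 (Fin n) → unitInterval) (X : Set (Fin n)) :
    (prodBernoulli v).real {ω : BondConfig (Fin n) | c ∉ openCluster (ω ∩ {e | ∀ x ∈ e, x ∉ X}) b} =
      (prodBernoulli v).real ((openConn b c)ᶜ ∩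
          ({ω : BondConfig (Fin n) | ∃ s ∈ X, ω ∈ openConn s b} ∩ {ω | ∃ s ∈ X, ω ∈ openConn s c})ᶜ) +
        (prodBernoulli v).real ({ω : BondConfig (Fin n) | c ∉ openCluster (ω ∩ {e | ∀ x ∈ e, x ∉ X}) b} ∩
          (openConn b c ∪ ({ω : BondConfig (Fin n) | ∃ s ∈ X, ω ∈ openConn s b} ∩ {ω | ∃ s ∈ X, ω ∈ openConn s c}))) := by
  conv_lhs => rw [offD_eq_gluedD_union b c X]
  exact measureReal_union (disjoint_gluedD_offX b c X) MeasurableSet.of_discrete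

/-- `μ(ED) = μ(U0) + μ(Eab) + μ(Eac)` for any product weights `v`. [folklore] -/
theorem real_gluedD_eq_add (v : Sym2 (Fin n) → unitInterval) (X : Set (Fin n)) :
    (prodBernoulli v).real ((openConn b c)ᶜ ∩
        ({ω : BondConfig (Fin n) | ∃ s ∈ X, ω ∈ openConn s b} ∩ {ω | ∃ s ∈ X, ω ∈ openConn s c})ᶜ) =
      (prodBernoulli v).real ({ω : BondConfig (Fin n) | ∃ s ∈ X, ω ∈ openConn s b}ᶜ ∩
          {ω | ∃ s ∈ X, ω ∈ openConn s c}ᶜ ∩ (openConn b c)ᶜ) +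
        ((prodBernoulli v).real ({ω : BondConfig (Fin n) | ∃ s ∈ X, ω ∈ openConn s b} ∩ {ω | ∃ s ∈ X, ω ∈ openConn s c}ᶜ) +
          (prodBernoulli v).real ({ω : BondConfig (Fin n) | ∃ s ∈ X, ω ∈ openConn s c} ∩ {ω | ∃ s ∈ X, ω ∈ openConn s b}ᶜ)) := by
  rw [gluedD_eq_union X b c, measureReal_union _ MeasurableSet.of_discrete, measureReal_union _ MeasurableSet.of_discrete]
  · rw [Set.disjoint_left]
    rintro ω ⟨hB, -⟩ ⟨-, hB'⟩
    exact hB' hB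
  · rw [Set.disjoint_left]
    rintro ω ⟨⟨hB, hC⟩, -⟩ h
    rcases h with ⟨hB', -⟩ | ⟨hC', -⟩
    · exact hB hB'
    · exact hC hC'

/-- **The per-pattern slack.**  Fix `0 < c₁ ≤ 1`, `|Sᶜ| ≤ m+2`, and assume the glued row with constant `c₁` for every weight
function and every apex set `S' ∌ b, c` with `|S'ᶜ| ≤ m+1`.  Then for every pattern `ξ` of the crossing pairs of `S`, under the
pinned law `ν_ξ`:  `c₁ · ν_ξ(ED) · ν_ξ(ET) ≤ ν_ξ(Eab) + ν_ξ(Eac)` (glued cells of `S`).  Cases: `b` or `c` is an endpoint of an open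
crossing pair (then `ν_ξ(U0) = 0`); no open crossing pair (then `ν_ξ(ET) = 0`); otherwise the induction hypothesis for `S ∪ R(ξ)`.
[this work] -/
theorem pattern_slack (hb : b ∉ S) (hc : c ∉ S) {c₁ : ℝ} (hc₁ : 0 < c₁) (hc₁1 : c₁ ≤ 1) {m : ℕ}
    (hcard : (Finset.univ \ S).card ≤ m + 2)
    (ih : ∀ (w' : Sym2 (Fin n) → unitInterval) (S' : Finset (Fin n)), b ∉ S' → c ∉ S' →
      (Finset.univ \ S').card ≤ m + 1 →
      c₁ * (prodBernoulli w').real ((openConn b c)ᶜ ∩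
            ({ω : BondConfig (Fin n) | ∃ s ∈ (S' : Set (Fin n)), ω ∈ openConn s b} ∩
              {ω | ∃ s ∈ (S' : Set (Fin n)), ω ∈ openConn s c})ᶜ) *
          (prodBernoulli w').real ({ω : BondConfig (Fin n) | ∃ s ∈ (S' : Set (Fin n)), ω ∈ openConn s b} ∪
            {ω | ∃ s ∈ (S' : Set (Fin n)), ω ∈ openConn s c}) ≤
        (prodBernoulli w').real ({ω : BondConfig (Fin n) | ∃ s ∈ (S' : Set (Fin n)), ω ∈ openConn s b} ∩
            {ω | ∃ s ∈ (S' : Set (Fin n)), ω ∈ openConn s c}ᶜ) +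
          (prodBernoulli w').real ({ω : BondConfig (Fin n) | ∃ s ∈ (S' : Set (Fin n)), ω ∈ openConn s c} ∩
            {ω | ∃ s ∈ (S' : Set (Fin n)), ω ∈ openConn s b}ᶜ))
    (ξ : Finset (Sym2 (Fin n))) :
    c₁ * (prodBernoulli (pinW w
          (↑(Finset.univ.filter fun e : Sym2 (Fin n) => (∃ x ∈ S, x ∈ e) ∧ ∃ y ∈ e, y ∉ S) : Set (Sym2 (Fin n))) ↑ξ)).real
          ((openConn b c)ᶜ ∩ ({ω : BondConfig (Fin n) | ∃ s ∈ (S : Set (Fin n)), ω ∈ openConn s b} ∩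
            {ω | ∃ s ∈ (S : Set (Fin n)), ω ∈ openConn s c})ᶜ) *
        (prodBernoulli (pinW w
          (↑(Finset.univ.filter fun e : Sym2 (Fin n) => (∃ x ∈ S, x ∈ e) ∧ ∃ y ∈ e, y ∉ S) : Set (Sym2 (Fin n))) ↑ξ)).real
          ({ω : BondConfig (Fin n) | ∃ s ∈ (S : Set (Fin n)), ω ∈ openConn s b} ∪
            {ω | ∃ s ∈ (S : Set (Fin n)), ω ∈ openConn s c}) ≤
      (prodBernoulli (pinW w
          (↑(Finset.univ.filter fun e : Sym2 (Fin n) => (∃ x ∈ S, x ∈ e) ∧ ∃ y ∈ e, y ∉ S) : Set (Sym2 (Fin n))) ↑ξ)).real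
          ({ω : BondConfig (Fin n) | ∃ s ∈ (S : Set (Fin n)), ω ∈ openConn s b} ∩
            {ω | ∃ s ∈ (S : Set (Fin n)), ω ∈ openConn s c}ᶜ) +
        (prodBernoulli (pinW w
          (↑(Finset.univ.filter fun e : Sym2 (Fin n) => (∃ x ∈ S, x ∈ e) ∧ ∃ y ∈ e, y ∉ S) : Set (Sym2 (Fin n))) ↑ξ)).real
          ({ω : BondConfig (Fin n) | ∃ s ∈ (S : Set (Fin n)), ω ∈ openConn s c} ∩
            {ω | ∃ s ∈ (S : Set (Fin n)), ω ∈ openConn s b}ᶜ) := by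
  set F := (Finset.univ.filter fun e : Sym2 (Fin n) => (∃ x ∈ S, x ∈ e) ∧ ∃ y ∈ e, y ∉ S) with hF
  set ν := prodBernoulli (pinW w (↑F : Set (Sym2 (Fin n))) ↑ξ) with hν
  set R := (Finset.univ.filter fun t : Fin n => t ∉ S ∧ ∃ s ∈ S, s(s, t) ∈ ξ) with hR
  set SB : Set (BondConfig (Fin n)) := {ω | ∃ s ∈ (S : Set (Fin n)), ω ∈ openConn s b} with hSB
  set SC : Set (BondConfig (Fin n)) := {ω | ∃ s ∈ (S : Set (Fin n)), ω ∈ openConn s c} with hSC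
  have hpat := ae_pin_pattern w S ξ
  have hD0 : 0 ≤ ν.real ((openConn b c)ᶜ ∩ (SB ∩ SC)ᶜ) := measureReal_nonneg
  have hT1 : ν.real (SB ∪ SC) ≤ 1 := measureReal_le_one
  have hT0 : 0 ≤ ν.real (SB ∪ SC) := measureReal_nonneg
  have hab0 : 0 ≤ ν.real (SB ∩ SCᶜ) := measureReal_nonneg
  have hac0 : 0 ≤ ν.real (SC ∩ SBᶜ) := measureReal_nonneg
  -- a target hit directly by an open crossing pair kills `U0`
  have hit : ∀ {x : Fin n} (X : Set (BondConfig (Fin n))), X = {ω | ∃ s ∈ (S : Set (Fin n)), ω ∈ openConn s x} →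
      x ∈ R → ν.real Xᶜ = 0 := by
    intro x X hX hxR
    obtain ⟨-, hxS, s, hs, hsx⟩ := Finset.mem_filter.1 hxR
    rw [measureReal_eq_zero_iff]
    refine (measure_eq_zero_iff_ae_notMem.2 ?_)
    filter_upwards [hpat] with ω hω
    rw [Set.mem_compl_iff, not_not, hX]
    have hopen : s(s, x) ∈ ω := (hω _ (mem_crossing S hs hxS)).2 hsx
    refine ⟨s, Finset.mem_coe.2 hs, ?_⟩
    have hadj : (openGraph ω).Adj s x := by rw [openGraph_adj]; exact ⟨hopen, fun h => hxS (h ▸ hs)⟩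
    exact hadj.reachable
  have hED_le : ν.real ((openConn b c)ᶜ ∩ (SB ∩ SC)ᶜ) ≤
      ν.real (SBᶜ ∩ SCᶜ ∩ (openConn b c)ᶜ) + (ν.real (SB ∩ SCᶜ) + ν.real (SC ∩ SBᶜ)) := by
    rw [real_gluedD_eq_add b c _ (S : Set (Fin n))]
  by_cases hbR : b ∈ R
  · have h0 : ν.real (SBᶜ ∩ SCᶜ ∩ (openConn b c)ᶜ) = 0 := by
      refine le_antisymm (le_trans (measureReal_mono ?_) (le_of_eq (hit SB hSB hbR))) measureReal_nonneg
      exact fun ω h => h.1.1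
    rw [h0, zero_add] at hED_le
    nlinarith [mul_le_mul_of_nonneg_left hT1 hD0]
  by_cases hcR : c ∈ R
  · have h0 : ν.real (SBᶜ ∩ SCᶜ ∩ (openConn b c)ᶜ) = 0 := by
      refine le_antisymm (le_trans (measureReal_mono ?_) (le_of_eq (hit SC hSC hcR))) measureReal_nonneg
      exact fun ω h => h.1.2
    rw [h0, zero_add] at hED_le
    nlinarith [mul_le_mul_of_nonneg_left hT1 hD0]
  by_cases hRne : R.Nonempty
  · -- the induction hypothesis for `S ∪ R`
    obtain ⟨r, hr⟩ := hRne
    have hrS : r ∉ S := (Finset.mem_filter.1 hr).2.1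
    have hb' : b ∉ S ∪ R := by rw [Finset.mem_union, not_or]; exact ⟨hb, hbR⟩
    have hc' : c ∉ S ∪ R := by rw [Finset.mem_union, not_or]; exact ⟨hc, hcR⟩
    have hcard' : (Finset.univ \ (S ∪ R)).card ≤ m + 1 := by
      have hss : Finset.univ \ (S ∪ R) ⊂ Finset.univ \ S := by
        rw [Finset.ssubset_iff_subset_ne]
        refine ⟨fun x hx => ?_, fun h => ?_⟩
        · rw [Finset.mem_sdiff, Finset.mem_union, not_or] at hx
          exact Finset.mem_sdiff.2 ⟨hx.1, hx.2.1⟩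
        · have : r ∈ Finset.univ \ S := Finset.mem_sdiff.2 ⟨Finset.mem_univ _, hrS⟩
          rw [← h, Finset.mem_sdiff, Finset.mem_union, not_or] at this
          exact this.2.2 hr
      have := Finset.card_lt_card hss
      omega
    have key := ih (pinW w (↑F : Set (Sym2 (Fin n))) ↑ξ) (S ∪ R) hb' hc' hcard'
    have eD : ν.real ((openConn b c)ᶜ ∩ (SB ∩ SC)ᶜ) = ν.real ((openConn b c)ᶜ ∩
        ({ω : BondConfig (Fin n) | ∃ s ∈ (↑(S ∪ R) : Set (Fin n)), ω ∈ openConn s b} ∩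
          {ω | ∃ s ∈ (↑(S ∪ R) : Set (Fin n)), ω ∈ openConn s c})ᶜ) :=
      pin_real_glued_eq w S b c ξ (fun p q r => ¬ r ∧ ¬ (p ∧ q))
    have eT : ν.real (SB ∪ SC) = ν.real ({ω : BondConfig (Fin n) | ∃ s ∈ (↑(S ∪ R) : Set (Fin n)), ω ∈ openConn s b} ∪
          {ω | ∃ s ∈ (↑(S ∪ R) : Set (Fin n)), ω ∈ openConn s c}) :=
      pin_real_glued_eq w S b c ξ (fun p q _ => p ∨ q)
    have eab : ν.real (SB ∩ SCᶜ) = ν.real ({ω : BondConfig (Fin n) | ∃ s ∈ (↑(S ∪ R) : Set (Fin n)), ω ∈ openConn s b} ∩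
          {ω | ∃ s ∈ (↑(S ∪ R) : Set (Fin n)), ω ∈ openConn s c}ᶜ) :=
      pin_real_glued_eq w S b c ξ (fun p q _ => p ∧ ¬ q)
    have eac : ν.real (SC ∩ SBᶜ) = ν.real ({ω : BondConfig (Fin n) | ∃ s ∈ (↑(S ∪ R) : Set (Fin n)), ω ∈ openConn s c} ∩
          {ω | ∃ s ∈ (↑(S ∪ R) : Set (Fin n)), ω ∈ openConn s b}ᶜ) :=
      pin_real_glued_eq w S b c ξ (fun p q _ => q ∧ ¬ p)
    rw [eD, eT, eab, eac]
    exact key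
  · -- no open crossing pair: the apex set reaches nothing outside `S`
    have hT : ν.real (SB ∪ SC) = 0 := by
      rw [measureReal_eq_zero_iff]
      refine (measure_eq_zero_iff_ae_notMem.2 ?_)
      filter_upwards [hpat] with ω hω hω'
      have aux : ∀ {x : Fin n}, x ∉ S → (∃ s ∈ (S : Set (Fin n)), ω ∈ openConn s x) → False := by
        intro x hxS hx
        obtain ⟨s, hs, t, htS, hst⟩ := exists_crossing_of_setConn (fun h => hxS (Finset.mem_coe.1 h)) hx
        have hsS : s ∈ S := Finset.mem_coe.1 hs
        have htS' : t ∉ S := fun h => htS (Finset.mem_coe.2 h)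
        have hξ : s(s, t) ∈ ξ := (hω _ (mem_crossing S hsS htS')).1 hst
        exact hRne ⟨t, Finset.mem_filter.2 ⟨Finset.mem_univ _, htS', s, hsS, hξ⟩⟩
      rcases hω' with h | h
      · exact aux hb h
      · exact aux hc h
    rw [hT, mul_zero]
    positivity

end Slack

end APL

end Summit.CriticalPhenomena.PercolationContinuityZ3.Theorems

end
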